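import Literature.Probability.Percolation.MarkedLoopBoundarySpanCriterion
import HarnessLib

/-!
# The total mass of a boundary law is `2 ^ #G`: every boundary mid-edge realises some outermost pattern («LAWPOINT-MASS»)

Topic `Literature/Probability/Percolation`; generic-`k` layer of the marked-loop (Khristoforov–Smirnov) lineage; a rider on `MarkedLoopBoundarySpanCriterion.lean` (`totalMass_lawLP`:
the total mass of the boundary link-pattern law `lawLP z` is `Σ_{q ∈ Pat₀} N_q(z)`; the stability criteria ask for ONE realised pattern `∃ D z q, N_q(z) ≠ 0`) and on
`KhSThreeDisorderNormalisation.lean` (`card_TXb_add_card_TXb`: `#W = 2 ^ #G` on the two halves of the subdivided edge; `existsUnique_inClassX`: every configuration has exactly one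
partner), `MarkedLoopTripodBasis.lean` (`patternCount`, `isPattern_linkRel`, `patternCount_eq_zero_of_boundary`), `MarkedLoopTripodCuts.lean` (`outAt`, `cutCompat_iff_lt`).

* ★ `sum_patternCount_eq_two_pow` — **`Σ_{p : Pat k} N_p(z) = 2 ^ #G`** at every side of a face with three `H_G`-sides whose endpoints are not corner faces (`k` odd): the
  configurations are partitioned by their (partner, link relation);
* `patternCount_eq_zero_of_not_mem_outAt` — on the arc `A_a` a pattern NOT compatible with the cut at `a` is never realised (the arc law, `patternCount_eq_zero_of_boundary`
  packaged with `cutCompat_iff_lt`);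
* ★ `sum_patternCount_outAt_eq_two_pow` — hence `Σ_{p ∈ outAt a} N_p(z) = 2 ^ #G` at a boundary mid-edge `z ∈ A_a`;
* ★★ `totalMass_lawLP_eq_two_pow` — **the total mass of every home-arc boundary law is `2 ^ #G`** (`k = 2m+1`); ★★ `exists_patternCount_ne_zero` — every home-arc boundary mid-edge
  realises SOME outermost pattern; so the «one realised pattern» hypothesis of «BSPAN-STABILITY-CRITERION» (#649), «BSPAN-CORNER-CRITERION» (#690) and «BSPAN-SIDEWAYS-CRITERION»
  (#744) is discharged by ANY lawpoint: ★ `realised_of_arcPoint`.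

## References
* M. Khristoforov, S. Smirnov, *Percolation and O(1) loop model*, arXiv:2111.15612 (2021), §1.2 (arXiv v1 p. 2: «there are exactly `2^{#F(Ω)}` loop configurations with given
  disorders»; «IP(ξ) is a union of disjoint paths, matching marked points»), §2 Definition 3 (p. 4), eq. (4) and Remark 6 (p. 5).
* P. A. Pearce, V. Rittenberg, J. de Gier, B. Nienhuis, *Temperley–Lieb stochastic processes*, J. Phys. A 35 (2002) L661–L668, §2 (link patterns).

## Mathlib / tree
Mathlib: `Finset.card_eq_sum_ones`, `Finset.sum_comm`, `Finset.sum_ite`, `Finset.sum_subset`, `Fintype.sum_subtype`-style `Finset.sum_subtype`. Tree: `MarkedLoopBoundarySpanCriterion`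
(`totalMass_lawLP`), `KhSThreeDisorderNormalisation` (`card_TXb_add_card_TXb`, `existsUnique_inClassX`), `MarkedLoopTripodBasis` (`Pat`, `Pat₀`, `patternCount`, `isPattern_linkRel`,
`patternCount_eq_zero_of_boundary`), `MarkedLoopTripodCuts` (`outAt`, `mem_outAt`, `cutCompat_iff_lt`), `MarkedLoopBoundaryLawModule` (`mem_outAt_last_iff`), `MarkedLoopBoundarySpan`
(`ArcPoint`), `MarkedLoopSpace` (`corners`), `KhSThreeDisorderObservable` (`TXb`, `InClassX`, `AllSides`).
-/

open Finset

namespace Literature.Probability.Percolation.MarkedLoops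

open Literature.Probability.Percolation Literature.Probability.LatticeModels
open Literature.Probability.LatticeModels.TemperleyLieb
open Literature.Probability.Percolation.FivePoint (side)
open TriMarkedDomain

section Mass

variable {nm : ℕ} {D : TriMarkedDomain nm}

open Classical in
/-- a finite set partitioned by `∃!`-classes: its cardinality is the sum of the class cardinalities. [cite: KhristoforovSmirnov2021, §1.2 (arXiv v1 p. 2); lane plumbing] -/
private theorem card_eq_sum_card_classes_pat {α β : Type*} [Fintype β] (S : Finset α) (P : β → α → Prop)
    (h : ∀ a ∈ S, ∃! b : β, P b a) : #S = ∑ b, #(S.filter fun a => P b a) := by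
  simp only [Finset.card_filter]
  rw [Finset.sum_comm, Finset.card_eq_sum_ones]
  refine Finset.sum_congr rfl fun a ha => ?_
  obtain ⟨b, hb, huniq⟩ := h a ha
  rw [Finset.sum_ite, Finset.sum_const_zero, add_zero, Finset.sum_const, smul_eq_mul, mul_one]
  have : (Finset.univ.filter fun b' : β => P b' a) = {b} := by
    ext b'
    simp only [Finset.mem_filter, Finset.mem_univ, true_and, Finset.mem_singleton]
    exact ⟨fun h' => huniq b' h', fun h' => h' ▸ hb⟩
  rw [this, Finset.card_singleton]

open Classical in
/-- **every configuration has exactly one PATTERN** (partner and link relation), on each half of the subdivided edge.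
[cite: KhristoforovSmirnov2021, §1.2 (arXiv v1 p. 2: «IP(ξ) is a union of disjoint paths, matching marked points»); §2 Definition 3 (p. 4)] -/
theorem existsUnique_pattern {v : HexVertex} (hv : AllSides D v) (i : Fin 3) {s : HexVertex}
    (hs : s ∈ ({v, oppFace v i} : Finset HexVertex)) (hsc : s ∉ corners D) {ξ : Finset (Sym2 (Site 2))} (hξ : ξ ∈ TXb D v i s) :
    ∃! p : Pat nm, InClassX D (faceVertex v (i + 1)) (faceVertex v (i + 2)) s p.1.1 ξ ∧ linkRel D ξ = p.1.2 := by
  obtain ⟨j, hj, huniq⟩ := existsUnique_inClassX D hv i hs hξ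
  refine ⟨⟨(j, linkRel D ξ), isPattern_linkRel hv hs hsc hξ hj⟩, ⟨hj, rfl⟩, ?_⟩
  rintro p ⟨hp, hL⟩
  apply Subtype.ext
  exact Prod.ext (huniq _ hp) hL.symm

open Classical in
/-- **`Σ_p N_p = #W` on each half of the subdivided edge.** [cite: KhristoforovSmirnov2021, §1.2 (arXiv v1 p. 2); §2 Definition 3 (p. 4)] -/
theorem sum_card_filter_pattern {v : HexVertex} (hv : AllSides D v) (i : Fin 3) {s : HexVertex}
    (hs : s ∈ ({v, oppFace v i} : Finset HexVertex)) (hsc : s ∉ corners D) :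
    ∑ p : Pat nm, #((TXb D v i s).filter fun ξ => InClassX D (faceVertex v (i + 1)) (faceVertex v (i + 2)) s p.1.1 ξ ∧ linkRel D ξ = p.1.2) =
      #(TXb D v i s) := by
  have h := card_eq_sum_card_classes_pat (TXb D v i s)
    (fun (p : Pat nm) ξ => InClassX D (faceVertex v (i + 1)) (faceVertex v (i + 2)) s p.1.1 ξ ∧ linkRel D ξ = p.1.2)
    (fun _ hξ => existsUnique_pattern hv i hs hsc hξ)
  convert h.symm using 3
  ext ξ
  simp only [Finset.mem_filter]

/-- ★ **`Σ_{p : Pat k} N_p(z) = 2 ^ #G`** (`k` odd) at every side of a face with three `H_G`-sides whose two endpoint faces are not corner faces.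
[cite: KhristoforovSmirnov2021, §1.2 (arXiv v1 p. 2: «there are exactly `2^{#F(Ω)}` loop configurations with given disorders»); §2 Definition 3 (p. 4)] -/
theorem sum_patternCount_eq_two_pow (hodd : Odd nm) {v : HexVertex} (hv : AllSides D v) {i : Fin 3} (hvc : v ∉ corners D)
    (hoc : oppFace v i ∉ corners D) : ∑ p : Pat nm, patternCount D v i p = 2 ^ #D.verts := by
  classical
  unfold patternCount
  rw [Finset.sum_add_distrib, sum_card_filter_pattern hv i (by simp) hvc, sum_card_filter_pattern hv i (by simp) hoc,
    card_TXb_add_card_TXb D hodd hv i]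

/-- **on the arc `A_a` a pattern not compatible with the cut at `a` is never realised** (the arc law, packaged).
[cite: KhristoforovSmirnov2021, §1.2 (arXiv v1 p. 2) and §2 eq. (4) (p. 5)] -/
theorem patternCount_eq_zero_of_not_mem_outAt {v : HexVertex} (hv : AllSides D v) {i : Fin 3} (hvc : v ∉ corners D) (hoc : oppFace v i ∉ corners D)
    {g o : Site 2} (he : side v i = s(g, o)) {a : Fin nm} (hd : (g, o) ∈ D.stretch a) {p : Pat nm} (hp : p ∉ outAt a) :
    patternCount D v i p = 0 := by
  have hp' : ∃ cd ∈ p.1.2, cd.1 < cd.2 ∧ ¬ ((cd.1 < p.1.1 ∧ p.1.1 < cd.2) ↔ (cd.1 ≤ a ∧ a < cd.2)) := by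
    by_contra hcon
    apply hp
    rw [mem_outAt, cutCompat_iff_lt]
    intro cd hcd hlt
    by_contra hne
    exact hcon ⟨cd, hcd, hlt, hne⟩
  obtain ⟨cd, hcd, hlt, hsep⟩ := hp'
  exact patternCount_eq_zero_of_boundary hv hvc hoc he hd p hcd hlt hsep

/-- ★ **`Σ_{p ∈ outAt a} N_p(z) = 2 ^ #G` at a boundary mid-edge `z ∈ A_a`** (`k` odd). [cite: KhristoforovSmirnov2021, §1.2 (arXiv v1 p. 2); §2 eq. (4) and Remark 6 (p. 5)] -/
theorem sum_patternCount_outAt_eq_two_pow (hodd : Odd nm) {a : Fin nm} (z : ArcPoint D a) :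
    ∑ p ∈ outAt a, patternCount D z.v z.i p = 2 ^ #D.verts := by
  rw [← sum_patternCount_eq_two_pow hodd z.allSides z.not_corner z.opp_not_corner]
  refine Finset.sum_subset (Finset.subset_univ _) fun p _ hp => ?_
  exact patternCount_eq_zero_of_not_mem_outAt z.allSides z.not_corner z.opp_not_corner z.side_eq z.mem_stretch hp

end Mass

section HomeArc

variable {m : ℕ} {D : TriMarkedDomain (2 * m + 1)}

/-- ★★ **THE TOTAL MASS OF EVERY HOME-ARC BOUNDARY LAW IS `2 ^ #G`** (`k = 2m+1` marks).
[cite: KhristoforovSmirnov2021, §1.2 (arXiv v1 p. 2: «there are exactly `2^{#F(Ω)}` loop configurations with given disorders»); PearceRittenbergDeGierNienhuis2002, §2] -/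
theorem totalMass_lawLP_eq_two_pow (z : ArcPoint D (Fin.last (2 * m))) : totalMass ℂ (lawLP z) = (2 : ℂ) ^ #D.verts := by
  have hodd : Odd (2 * m + 1) := ⟨m, rfl⟩
  rw [totalMass_lawLP z]
  have h := sum_patternCount_outAt_eq_two_pow hodd z
  -- rewrite the sum over `outAt (last)` as the sum over the subtype `Pat₀`
  have e : ∑ q : Pat₀ (2 * m + 1), patternCount D z.v z.i q.1 = ∑ p ∈ outAt (Fin.last (2 * m)), patternCount D z.v z.i p := by
    rw [← Finset.sum_subtype (outAt (Fin.last (2 * m))) (p := fun p : Pat (2 * m + 1) => p.pdepth = 0) (fun p => mem_outAt_last_iff p)]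
  rw [e, h]
  push_cast
  rfl

/-- ★★ **EVERY HOME-ARC BOUNDARY MID-EDGE REALISES SOME OUTERMOST PATTERN.** [cite: KhristoforovSmirnov2021, §1.2 (arXiv v1 p. 2); §2 eq. (4) and Remark 6 (p. 5)] -/
theorem exists_patternCount_ne_zero (z : ArcPoint D (Fin.last (2 * m))) : ∃ q : Pat₀ (2 * m + 1), patternCount D z.v z.i q.1 ≠ 0 := by
  by_contra h
  push Not at h
  have hmass := totalMass_lawLP_eq_two_pow z
  rw [totalMass_lawLP z, Finset.sum_eq_zero (fun q _ => h q), Nat.cast_zero] at hmass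
  exact (pow_ne_zero _ (two_ne_zero (α := ℂ))) hmass.symm

/-- ★ **the «one realised pattern» hypothesis of the boundary-span criteria holds as soon as one home-arc lawpoint exists.**
[cite: KhristoforovSmirnov2021, §1.2 (arXiv v1 p. 2); §2 eq. (4) and Remark 6 (p. 5)] -/
theorem realised_of_arcPoint (D₀ : TriMarkedDomain (2 * m + 1)) (z₀ : ArcPoint D₀ (Fin.last (2 * m))) :
    ∃ (D : TriMarkedDomain (2 * m + 1)) (z : ArcPoint D (Fin.last (2 * m))) (q : Pat₀ (2 * m + 1)), patternCount D z.v z.i q.1 ≠ 0 := by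
  obtain ⟨q, hq⟩ := exists_patternCount_ne_zero z₀
  exact ⟨D₀, z₀, q, hq⟩

end HomeArc

end Literature.Probability.Percolation.MarkedLoops
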